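import Summits.HubbardSuperconductivity.HubbardSuperconductivity.Theorems.BcsKacWindowInfraredCompletionVolumeMonotone

/-!
# Crux `InfraredCompletion` (stmt-HubbardSuperconductivity-1321, route BcsKacWindow), line `birth`:
# stub A (`stub_softWindowFloor`) from hypothesis W and a volume HEREDITY of pair weight WITH SLACK

Companion of `BcsKacWindowInfraredCompletionVolumeMonotone.lean` (`stub_softWindowFloor_of_volumeMonotone`,
p154802: stub A ⇐ W ∧ `hVM`, where `hVM` is the error-free, `U`-uniform "Griffiths-in-volume"
heredity of coarse-grained `d`-wave pair weight across ONE octave of even sides). Stub A of the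
skeleton `Cruxes/InfraredCompletion/Lines/birth.lean` is a SIZE TRANSFER, and a supplier scan of the
tree (worker of lead c17, 2026-08-17: every `Literature/MathematicalPhysics/QuantumLattice/*` file
landed on 2026-08-17 and every `Theorems/*` file mentioning `pairStructureFactor`) finds that sector
ground states of `hubbardTorus` at two different sides are still compared only through ENERGIES
(`HubbardOpenBoxVersusTorus`, `HubbardBoxSectorEnergyBounds`, `HubbardStateSectorDecomposition`,
`HubbardEnergyDensityVariationalPrinciple`, `FermionTorusBlockTiling`, `SourcedHubbardBlockCut`), through
same-side transfers (`BcsKacWindowCoherenceWindowLRO*Transfer`, `GriffithsLemmaGroundStates` — Griffiths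
in the COUPLING, not in the volume) or through infinite-volume limits (`InfVolFermionState*`); no
declaration transports a ground-state EXPECTATION floor from one side to a larger one.

This file records how much SLACK the bookkeeping of stub A tolerates in that missing cross-volume
input, by proving stub A from W and the following hypothesis `hVH` (first antecedent of
`stub_softWindowFloor_of_volumeHeredity`, explicit, never asserted; conjecture-grade), which relaxes
`hVM` in five independent ways, each absorbed by the free window parameter `t` of stub A:

1. a RANGE parameter `K ≥ 1`: the input order may be assumed on every even side of `[L'/K, L']`
   (not only on the octave `[L'/2, L']`);
2. the input order may be assumed at EVERY doping `δ' ∈ [a,b]` (not only at the target `δ`) — what a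
   block argument with fluctuating block particle numbers would consume;
3. SCALE SEPARATION: the conclusion is only required on sides `L ≥ K·L'`;
4. a wider conclusion WINDOW, radius `2πK/L'` instead of `2π/L'`;
5. an additive FINITE-SIZE ERROR `E·L²/L'²` (`E ≥ 0`): the floor reads
   `C·θ·L² - E·L²/L'² ≤ Σ_{|q_m|² ≤ (2πK/L')²} S_ψ(m)`, i.e. heredity up to a correction of relative
   size `E/(C·θ·L'²)` — it only bites when the input pair weight `θ·L'²` is large in absolute terms.

* `stub_softWindowFloor_of_volumeHeredity` — `hVH` ⇒ the registered signature of stub A verbatim, with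
  `c_A = min(1, C/2)·c₀`, `s_A = max(max(s₀, L₀), max(1, E/(C·c₀)))`,
  `U_A(t) = min(U₁(K(2πKt+2)), U⋆)`. Proof: for `Δ(U)·L ≤ K(2πKt+2)` hypothesis W applies at `L`
  itself and `S_ψ(0)` lies in the window; otherwise an even `L' ∈ [2πKt/Δ(U), 2πKt/Δ(U)+2)` has
  `K·L' ≤ L`, the range `[L'/K, L']` lies inside W's window `[s₀/Δ(U), K(2πKt+2)/Δ(U)]` at every
  `δ' ∈ [a,b]`, W gives `θ = c₀Δ(U)²` there, `hVH` returns `C·c₀Δ²L² - E·L²/L'²` at radius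
  `2πK/L' ≤ Δ(U)/t`, and `E·L²/L'² ≤ E·Δ²L²/(4π²K²t²) ≤ (C/2)·c₀Δ²L²` because `t ≥ 1`, `t ≥ E/(C·c₀)`.
* `volumeHeredity_of_volumeMonotone` — `hVM` ⇒ `hVH` (`K = 2`, `E = 0`): the new hypothesis is
  implied by the old one, so this reduction asks for no more than p154802.

What the slack says about the missing input: a Griffiths/Ruelle-type block argument produces
boundary errors of relative size `1/L'` per site (surface/volume), i.e. `E'·L²/L'`, which is NOT
affordable here (`θ = c₀Δ(U)²` while `1/L' ≍ Δ(U)/t`); only second-order corrections `O(L²/L'²)` are.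
No physics is used and nothing here proves `hVH`, `hVM`, stub A or the crux. Kennedy–Lieb–Shastry,
PRL 61 (1988) 2582 (Fourier bookkeeping of an order operator); Griffiths, Phys. Rev. 152 (1966) 240
(block versus global order). [folklore] No definition is introduced.
-/

noncomputable section

-- the mandated namespace `Summit.<Summit>.<Problem>.Theorems…` repeats `HubbardSuperconductivity`
-- (single-problem summit, D-0017), which the `dupNamespace` linter flags on every declaration
set_option linter.dupNamespace false

namespace Summit.HubbardSuperconductivity.HubbardSuperconductivity.Theorems.InfraredCompletion

open Literature.MathematicalPhysics.QuantumLattice Literature.Probability.LatticeModels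
open scoped Classical Matrix BigOperators

/-- **An even side in every window of length two**: for `x > 0` there is an even natural number
`L'` with `2x ≤ L' < 2x + 2` (namely `L' = 2⌈x⌉`), and `L' > 0`. [folklore] -/
private theorem exists_even_side' (x : ℝ) (hx : 0 < x) :
    ∃ L' : ℕ, 0 < L' ∧ Even L' ∧ 2 * x ≤ (L' : ℝ) ∧ (L' : ℝ) < 2 * x + 2 := by
  refine ⟨2 * ⌈x⌉₊, ?_, even_two_mul _, ?_, ?_⟩
  · have : 0 < ⌈x⌉₊ := Nat.ceil_pos.2 hx
    omega
  · have h := Nat.le_ceil x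
    push_cast
    linarith
  · have h := Nat.ceil_lt_add_one hx.le
    push_cast
    linarith

/-- **Stub A from W and a volume heredity of coarse-grained pair weight with slack** (sub-goal of
line `birth`, crux `InfraredCompletion`). Hypothesis (first antecedent, the missing cross-volume
input `hVH`, localized to small `U` and `δ ∈ [a,b]`): for every `[a,b] ⊂ (0,1/2)` there are
`K ≥ 1`, `C > 0`, `E ≥ 0`, `L₀`, `U⋆ > 0` such that for `U ∈ (0,U⋆)`, `δ ∈ [a,b]`, even sides `L'`,
`L` with `L₀ ≤ L'`, `K·L' ≤ L` and any `θ`: if at EVERY `δ' ∈ [a,b]` every normalised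
`(2⌊(1-δ')L''²/2⌋, S^z = 0)`-sector ground state of `hubbardTorus 2 L'' 1 U` on every even side
`L''` with `L' ≤ K·L''`, `L'' ≤ L'` has `θ·L''² ≤ S_{ψ''}(0)`, then every normalised sector ground
state on side `L` at `δ` has `C·θ·L² - E·L²/L'² ≤ Σ_{m : |q_m|² ≤ (2πK/L')²} S_ψ(m)`
(`S = pairStructureFactor dWaveFormFactor`). Remaining antecedents and conclusion: the signature of
`stub_softWindowFloor` verbatim (guards, flat pin, coherence-window bound W ⇒ soft-window floor on all
bulk tori), realised with `c_A = min(1, C/2)·c₀`, `s_A = max(max(s₀, L₀), max(1, E/(C·c₀)))`,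
`U_A(t) = min(U₁(K(2πKt+2)), U⋆)`: below `Δ(U)·L ≤ K(2πKt+2)` W applies at `L` and the zero mode
lies in the window; above, W feeds `θ = c₀Δ(U)²` on `[L'/K, L']` for an even
`L' ∈ [2πKt/Δ(U), 2πKt/Δ(U)+2)`, `K·L' ≤ L`, `hVH` returns the floor at radius `2πK/L' ≤ Δ(U)/t`,
and the error `E·L²/L'² ≤ E·Δ(U)²L²/(4π²K²t²)` is at most half the floor since `t ≥ max(1, E/(C·c₀))`.
Kennedy–Lieb–Shastry, PRL 61 (1988) 2582; Griffiths, Phys. Rev. 152 (1966) 240. [folklore] -/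
theorem stub_softWindowFloor_of_volumeHeredity :
    (∀ (a b : ℝ), 0 < a → a < b → b < 1 / 2 → ∃ K C E L₀ Ustar : ℝ, 1 ≤ K ∧ 0 < C ∧ 0 ≤ E ∧
      0 < Ustar ∧
      ∀ (U δ θ : ℝ) (L' L : ℕ) [NeZero L'] [NeZero L], 0 < U → U < Ustar → δ ∈ Set.Icc a b →
        Even L' → Even L → L₀ ≤ L' → K * L' ≤ L →
        (∀ δ' ∈ Set.Icc a b, ∀ (L'' : ℕ) [NeZero L''], Even L'' → (L' : ℝ) ≤ K * L'' → L'' ≤ L' →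
          ∀ ψ'' : Fock (Orb (FermionTorus 2 L'')), star ψ'' ⬝ᵥ ψ'' = 1 →
            IsGroundStateInSector (hubbardTorus 2 L'' 1 U) (2 * ⌊(1 - δ') * (L'' : ℝ) ^ 2 / 2⌋₊) 0
                ψ'' →
              θ * (L'' : ℝ) ^ 2 ≤ pairStructureFactor dWaveFormFactor L'' ψ'' 0) →
        ∀ ψ : Fock (Orb (FermionTorus 2 L)), star ψ ⬝ᵥ ψ = 1 →
          IsGroundStateInSector (hubbardTorus 2 L 1 U) (2 * ⌊(1 - δ) * (L : ℝ) ^ 2 / 2⌋₊) 0 ψ →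
            C * θ * (L : ℝ) ^ 2 - E * (L : ℝ) ^ 2 / (L' : ℝ) ^ 2 ≤
              ∑ m ∈ Finset.univ.filter
                  (fun m : Fin 2 → ZMod L =>
                    momentumNormSq L m ≤ (2 * Real.pi * K / (L' : ℝ)) ^ 2),
                pairStructureFactor dWaveFormFactor L ψ m) →
    ∀ (a b κ₁ κ₂ c₀ s₀ : ℝ) (Δ : ℝ → ℝ), 0 < a → a < b → b < 1 / 2 → 0 < κ₁ → κ₁ ≤ κ₂ → 0 < c₀ →
      0 < s₀ → (∀ U : ℝ, 0 < U → Real.exp (-(κ₂ / U ^ 2)) ≤ Δ U ∧ Δ U ≤ Real.exp (-(κ₁ / U ^ 2))) →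
      (∀ s : ℝ, s₀ ≤ s → ∃ U₁ : ℝ, 0 < U₁ ∧ ∀ δ ∈ Set.Icc a b, ∀ U ∈ Set.Ioo (0:ℝ) U₁,
        ∀ (L : ℕ) [NeZero L], Even L → s₀ ≤ Δ U * L → Δ U * L ≤ s →
          ∀ ψ : Fock (Orb (FermionTorus 2 L)), star ψ ⬝ᵥ ψ = 1 →
            IsGroundStateInSector (hubbardTorus 2 L 1 U) (2 * ⌊(1 - δ) * (L : ℝ) ^ 2 / 2⌋₊) 0 ψ →
              c₀ * Δ U ^ 2 ≤ (expect ((pairField dWaveFormFactor L)ᴴ * pairField dWaveFormFactor L)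
                ψ).re / (L : ℝ) ^ 4) →
      ∃ cA sA : ℝ, 0 < cA ∧ ∀ t : ℝ, sA ≤ t → ∃ UA : ℝ, 0 < UA ∧
        ∀ δ ∈ Set.Icc a b, ∀ U ∈ Set.Ioo (0:ℝ) UA, ∀ (L : ℕ) [NeZero L], Even L → t ≤ Δ U * L →
          ∀ ψ : Fock (Orb (FermionTorus 2 L)), star ψ ⬝ᵥ ψ = 1 →
            IsGroundStateInSector (hubbardTorus 2 L 1 U) (2 * ⌊(1 - δ) * (L : ℝ) ^ 2 / 2⌋₊) 0 ψ →
              cA * Δ U ^ 2 * (L : ℝ) ^ 2 ≤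
                ∑ m ∈ Finset.univ.filter
                    (fun m : Fin 2 → ZMod L => momentumNormSq L m ≤ (Δ U / t) ^ 2),
                  pairStructureFactor dWaveFormFactor L ψ m := by
  intro hVH a b κ₁ κ₂ c₀ s₀ Δ ha hab hb hκ₁ hκ₁₂ hc₀ hs₀ hpin hW
  obtain ⟨K, C, E, L₀, Ustar, hK, hC, hE, hUstar, hVH⟩ := hVH a b ha hab hb
  refine ⟨min 1 (C / 2) * c₀, max (max s₀ L₀) (max 1 (E / (C * c₀))),
    mul_pos (lt_min one_pos (half_pos hC)) hc₀, fun t ht => ?_⟩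
  have hts₀ : s₀ ≤ t := le_trans (le_trans (le_max_left _ _) (le_max_left _ _)) ht
  have htL₀ : L₀ ≤ t := le_trans (le_trans (le_max_right _ _) (le_max_left _ _)) ht
  have ht1 : 1 ≤ t := le_trans (le_trans (le_max_left _ _) (le_max_right _ _)) ht
  have htE : E / (C * c₀) ≤ t := le_trans (le_trans (le_max_right _ _) (le_max_right _ _)) ht
  have ht0 : 0 < t := lt_of_lt_of_le hs₀ hts₀
  have hK0 : 0 < K := lt_of_lt_of_le one_pos hK
  have hCc₀ : 0 < C * c₀ := mul_pos hC hc₀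
  have hπK : 3 ≤ Real.pi * K := by
    have h := mul_le_mul Real.pi_gt_three.le hK zero_le_one Real.pi_pos.le
    linarith only [h]
  -- `t ≤ 6t ≤ 2πKt`
  have h6t : 6 * t ≤ 2 * Real.pi * K * t := by
    linarith only [mul_nonneg ht0.le (sub_nonneg.2 hπK)]
  have h2πKt : t ≤ 2 * Real.pi * K * t := by linarith only [h6t, ht0]
  -- the window top fed to W is `K (2πKt + 2) ≥ 2πKt + 2 ≥ s₀`
  have htop0 : 0 ≤ 2 * Real.pi * K * t + 2 := by positivity
  have htop_ge : 2 * Real.pi * K * t + 2 ≤ K * (2 * Real.pi * K * t + 2) := by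
    linarith only [mul_nonneg (sub_nonneg.2 hK) htop0]
  have hs : s₀ ≤ K * (2 * Real.pi * K * t + 2) := by linarith only [hts₀, h2πKt, htop_ge]
  obtain ⟨U₁, hU₁, hWs⟩ := hW (K * (2 * Real.pi * K * t + 2)) hs
  refine ⟨min U₁ Ustar, lt_min hU₁ hUstar, ?_⟩
  intro δ hδ U hU L _ hL htL ψ hψ hGS
  have hU0 : 0 < U := hU.1
  have hUst : U < Ustar := lt_of_lt_of_le hU.2 (min_le_right _ _)
  have hUU₁ : U ∈ Set.Ioo (0:ℝ) U₁ := ⟨hU0, lt_of_lt_of_le hU.2 (min_le_left _ _)⟩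
  have hΔpos : 0 < Δ U := lt_of_lt_of_le (Real.exp_pos _) (hpin U hU0).1
  have hΔle : Δ U ≤ 1 := by
    refine le_trans (hpin U hU0).2 (Real.exp_le_one_iff.2 ?_)
    have : 0 ≤ κ₁ / U ^ 2 := by positivity
    linarith
  have hL0 : (0 : ℝ) < (L : ℝ) := Nat.cast_pos.2 (Nat.pos_of_ne_zero (NeZero.ne L))
  have hmin1 : min 1 (C / 2) ≤ 1 := min_le_left _ _
  have hminC : min 1 (C / 2) ≤ C / 2 := min_le_right _ _
  have hnn : 0 ≤ c₀ * Δ U ^ 2 * (L : ℝ) ^ 2 := by positivity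
  by_cases hcase : Δ U * L ≤ K * (2 * Real.pi * K * t + 2)
  · -- Case 1: `L` itself lies in W's window
    have hord := hWs δ hδ U hUU₁ L hL (le_trans hts₀ htL) hcase ψ hψ hGS
    have hL2 : (0 : ℝ) < (L : ℝ) ^ 2 := by positivity
    have hL4 : (0 : ℝ) < (L : ℝ) ^ 4 := by positivity
    rw [le_div_iff₀ hL4] at hord
    have hS0 : c₀ * Δ U ^ 2 * (L : ℝ) ^ 2 ≤ pairStructureFactor dWaveFormFactor L ψ 0 := by
      rw [pairStructureFactor_zero dWaveFormFactor L ψ, le_div_iff₀ hL2]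
      calc c₀ * Δ U ^ 2 * (L : ℝ) ^ 2 * (L : ℝ) ^ 2 = c₀ * Δ U ^ 2 * (L : ℝ) ^ 4 := by ring
        _ ≤ _ := hord
    calc min 1 (C / 2) * c₀ * Δ U ^ 2 * (L : ℝ) ^ 2
        = min 1 (C / 2) * (c₀ * Δ U ^ 2 * (L : ℝ) ^ 2) := by ring
      _ ≤ 1 * (c₀ * Δ U ^ 2 * (L : ℝ) ^ 2) := mul_le_mul_of_nonneg_right hmin1 hnn
      _ = c₀ * Δ U ^ 2 * (L : ℝ) ^ 2 := one_mul _
      _ ≤ pairStructureFactor dWaveFormFactor L ψ 0 := hS0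
      _ ≤ _ := pairStructureFactor_zero_le_softWindowSum ψ (Δ U / t)
  · -- Case 2: `Δ(U)·L > K(2πKt + 2)`; transfer from the even side `L' ∈ [2πKt/Δ, 2πKt/Δ + 2)`
    push Not at hcase
    have hx0 : 0 < Real.pi * K * t / Δ U := by positivity
    obtain ⟨L', hL'pos, hL'even, hL'ge, hL'lt⟩ := exists_even_side' (Real.pi * K * t / Δ U) hx0
    haveI : NeZero L' := ⟨hL'pos.ne'⟩
    have hL'r : (0 : ℝ) < (L' : ℝ) := Nat.cast_pos.2 hL'pos
    have h2x : 2 * (Real.pi * K * t / Δ U) = 2 * Real.pi * K * t / Δ U := by ring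
    rw [h2x] at hL'ge hL'lt
    -- `2πKt ≤ Δ L' ≤ 2πKt + 2`
    have hΔL'ge : 2 * Real.pi * K * t ≤ Δ U * L' := by
      have h := (div_le_iff₀ hΔpos).1 hL'ge
      linarith only [h, mul_comm (L' : ℝ) (Δ U)]
    have hΔL'le : Δ U * L' ≤ 2 * Real.pi * K * t + 2 := by
      have h := mul_lt_mul_of_pos_left hL'lt hΔpos
      have hkey : Δ U * (2 * Real.pi * K * t / Δ U + 2) = 2 * Real.pi * K * t + 2 * Δ U := by
        field_simp
      rw [hkey] at h
      linarith only [h, hΔle]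
    -- `K L' ≤ L`
    have hKL'leL : K * (L' : ℝ) ≤ (L : ℝ) := by
      have h1 : K * (Δ U * L') ≤ K * (2 * Real.pi * K * t + 2) :=
        mul_le_mul_of_nonneg_left hΔL'le hK0.le
      have h2 : Δ U * (K * L') < Δ U * L := by
        rw [mul_left_comm]
        exact lt_of_le_of_lt h1 hcase
      exact (lt_of_mul_lt_mul_left h2 hΔpos.le).le
    -- `L₀ ≤ L'`
    have hL₀L' : L₀ ≤ (L' : ℝ) := by
      have h1 : 2 * Real.pi * K * t ≤ 2 * Real.pi * K * t / Δ U := by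
        rw [le_div_iff₀ hΔpos]
        have h0 : 0 ≤ 2 * Real.pi * K * t := by positivity
        exact mul_le_of_le_one_right h0 hΔle
      linarith only [htL₀, h2πKt, h1, hL'ge]
    -- order on the range `[L'/K, L']` from W, at every `δ' ∈ [a,b]`
    have hθ : ∀ δ' ∈ Set.Icc a b, ∀ (L'' : ℕ) [NeZero L''], Even L'' → (L' : ℝ) ≤ K * L'' →
        L'' ≤ L' → ∀ ψ'' : Fock (Orb (FermionTorus 2 L'')), star ψ'' ⬝ᵥ ψ'' = 1 →
          IsGroundStateInSector (hubbardTorus 2 L'' 1 U) (2 * ⌊(1 - δ') * (L'' : ℝ) ^ 2 / 2⌋₊) 0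
              ψ'' →
            c₀ * Δ U ^ 2 * (L'' : ℝ) ^ 2 ≤ pairStructureFactor dWaveFormFactor L'' ψ'' 0 := by
      intro δ' hδ' L'' _ hL''even hL''ge hL''le ψ'' hψ'' hGS''
      have hL''r : (0 : ℝ) < (L'' : ℝ) := Nat.cast_pos.2 (Nat.pos_of_ne_zero (NeZero.ne L''))
      have hle : (L'' : ℝ) ≤ (L' : ℝ) := by exact_mod_cast hL''le
      have hlo : s₀ ≤ Δ U * L'' := by
        have h1 : Δ U * L' ≤ K * (Δ U * L'') :=
          calc Δ U * L' ≤ Δ U * (K * L'') := mul_le_mul_of_nonneg_left hL''ge hΔpos.le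
            _ = K * (Δ U * L'') := by ring
        have h2 : K * (2 * Real.pi * t) ≤ K * (Δ U * L'') :=
          calc K * (2 * Real.pi * t) = 2 * Real.pi * K * t := by ring
            _ ≤ Δ U * L' := hΔL'ge
            _ ≤ K * (Δ U * L'') := h1
        have h3 := le_of_mul_le_mul_left h2 hK0
        have h2π : (1 : ℝ) ≤ 2 * Real.pi := by linarith only [Real.pi_gt_three]
        have h4 : 1 * t ≤ 2 * Real.pi * t := mul_le_mul_of_nonneg_right h2π ht0.le
        linarith only [hts₀, h3, h4]
      have hhi : Δ U * L'' ≤ K * (2 * Real.pi * K * t + 2) := by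
        have h1 : Δ U * L'' ≤ Δ U * L' := mul_le_mul_of_nonneg_left hle hΔpos.le
        linarith only [h1, hΔL'le, htop_ge]
      have hord := hWs δ' hδ' U hUU₁ L'' hL''even hlo hhi ψ'' hψ'' hGS''
      have hL''2 : (0 : ℝ) < (L'' : ℝ) ^ 2 := by positivity
      have hL''4 : (0 : ℝ) < (L'' : ℝ) ^ 4 := by positivity
      rw [le_div_iff₀ hL''4] at hord
      rw [pairStructureFactor_zero dWaveFormFactor L'' ψ'', le_div_iff₀ hL''2]
      calc c₀ * Δ U ^ 2 * (L'' : ℝ) ^ 2 * (L'' : ℝ) ^ 2 = c₀ * Δ U ^ 2 * (L'' : ℝ) ^ 4 := by ring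
        _ ≤ _ := hord
    have hmain :=
      hVH U δ (c₀ * Δ U ^ 2) L' L hU0 hUst hδ hL'even hL hL₀L' hKL'leL hθ ψ hψ hGS
    -- the radius `2πK/L'` window sits inside the radius `Δ(U)/t` window
    have hrad : (2 * Real.pi * K / (L' : ℝ)) ^ 2 ≤ (Δ U / t) ^ 2 := by
      have h1 : 2 * Real.pi * K / (L' : ℝ) ≤ Δ U / t := by
        rw [div_le_div_iff₀ hL'r ht0]
        linarith only [hΔL'ge]
      have h0 : 0 ≤ 2 * Real.pi * K / (L' : ℝ) := by positivity
      exact pow_le_pow_left₀ h0 h1 2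
    have hsub : Finset.univ.filter
          (fun m : Fin 2 → ZMod L => momentumNormSq L m ≤ (2 * Real.pi * K / (L' : ℝ)) ^ 2) ⊆
        Finset.univ.filter (fun m : Fin 2 → ZMod L => momentumNormSq L m ≤ (Δ U / t) ^ 2) := by
      intro m hm
      simp only [Finset.mem_filter, Finset.mem_univ, true_and] at hm ⊢
      exact le_trans hm hrad
    have hmono := Finset.sum_le_sum_of_subset_of_nonneg hsub
      (fun m _ _ => pairStructureFactor_nonneg dWaveFormFactor L ψ m)
    -- the finite-size error is at most half the floor: `E L²/L'² ≤ (C/2) c₀ Δ² L²`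
    have herr : E * (L : ℝ) ^ 2 / (L' : ℝ) ^ 2 ≤ C / 2 * (c₀ * Δ U ^ 2 * (L : ℝ) ^ 2) := by
      have hL'2 : (0 : ℝ) < (L' : ℝ) ^ 2 := by positivity
      rw [div_le_iff₀ hL'2]
      have hEt : E ≤ C * c₀ * t := by
        have h := (div_le_iff₀ hCc₀).1 htE
        linarith only [h, mul_comm t (C * c₀)]
      have hEt2 : E ≤ C * c₀ * t ^ 2 := by
        have htt : t ≤ t ^ 2 :=
          calc t = t * 1 := (mul_one t).symm
            _ ≤ t * t := mul_le_mul_of_nonneg_left ht1 ht0.le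
            _ = t ^ 2 := (sq t).symm
        have h1 : C * c₀ * t ≤ C * c₀ * t ^ 2 := mul_le_mul_of_nonneg_left htt hCc₀.le
        linarith only [hEt, h1]
      have h6t' : 6 * t ≤ Δ U * L' := le_trans h6t hΔL'ge
      have hsq : 36 * t ^ 2 ≤ (Δ U * L') ^ 2 := by
        have h := pow_le_pow_left₀ (by positivity : (0 : ℝ) ≤ 6 * t) h6t' 2
        calc 36 * t ^ 2 = (6 * t) ^ 2 := by ring
          _ ≤ _ := h
      have hL2 : (0 : ℝ) ≤ (L : ℝ) ^ 2 := by positivity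
      have step1 : E * (L : ℝ) ^ 2 ≤ C * c₀ * t ^ 2 * (L : ℝ) ^ 2 :=
        mul_le_mul_of_nonneg_right hEt2 hL2
      have step2 : C * c₀ * t ^ 2 * (L : ℝ) ^ 2 ≤ C * c₀ * ((Δ U * L') ^ 2 / 36) * (L : ℝ) ^ 2 := by
        apply mul_le_mul_of_nonneg_right _ hL2
        apply mul_le_mul_of_nonneg_left _ hCc₀.le
        linarith only [hsq]
      have step3 : C * c₀ * ((Δ U * L') ^ 2 / 36) * (L : ℝ) ^ 2 ≤
          C / 2 * (c₀ * Δ U ^ 2 * (L : ℝ) ^ 2) * (L' : ℝ) ^ 2 := by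
        have hid : C / 2 * (c₀ * Δ U ^ 2 * (L : ℝ) ^ 2) * (L' : ℝ) ^ 2 =
            18 * (C * c₀ * ((Δ U * L') ^ 2 / 36) * (L : ℝ) ^ 2) := by ring
        rw [hid]
        have h0 : 0 ≤ C * c₀ * ((Δ U * L') ^ 2 / 36) * (L : ℝ) ^ 2 := by positivity
        linarith only [h0]
      linarith only [step1, step2, step3]
    calc min 1 (C / 2) * c₀ * Δ U ^ 2 * (L : ℝ) ^ 2
        = min 1 (C / 2) * (c₀ * Δ U ^ 2 * (L : ℝ) ^ 2) := by ring
      _ ≤ C / 2 * (c₀ * Δ U ^ 2 * (L : ℝ) ^ 2) := mul_le_mul_of_nonneg_right hminC hnn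
      _ = C * (c₀ * Δ U ^ 2) * (L : ℝ) ^ 2 - C / 2 * (c₀ * Δ U ^ 2 * (L : ℝ) ^ 2) := by ring
      _ ≤ C * (c₀ * Δ U ^ 2) * (L : ℝ) ^ 2 - E * (L : ℝ) ^ 2 / (L' : ℝ) ^ 2 := by
          linarith only [herr]
      _ ≤ _ := hmain
      _ ≤ _ := hmono

/-- **The slackened heredity is implied by the error-free octave heredity**: the hypothesis `hVM` of
`stub_softWindowFloor_of_volumeMonotone` (p154802) implies the hypothesis `hVH` of
`stub_softWindowFloor_of_volumeHeredity`, with `K = 2`, `E = 0` and the same `C, L₀, U⋆`: the input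
of `hVH` on `[L'/2, L']` at every `δ' ∈ [a,b]` contains the input of `hVM` (the octave at `δ`), and
the window of radius `2π/L'` sits inside the one of radius `4π/L'` (`pairStructureFactor_nonneg`).
So the reduction through `hVH` asks for no more than the one through `hVM`. [folklore] -/
theorem volumeHeredity_of_volumeMonotone :
    (∀ (a b : ℝ), 0 < a → a < b → b < 1 / 2 → ∃ C L₀ Ustar : ℝ, 0 < C ∧ 0 < Ustar ∧
      ∀ (U δ θ : ℝ) (L' L : ℕ) [NeZero L'] [NeZero L], 0 < U → U < Ustar → δ ∈ Set.Icc a b →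
        Even L' → Even L → L₀ ≤ L' → L' ≤ L →
        (∀ (L'' : ℕ) [NeZero L''], Even L'' → (L' : ℝ) ≤ 2 * L'' → L'' ≤ L' →
          ∀ ψ'' : Fock (Orb (FermionTorus 2 L'')), star ψ'' ⬝ᵥ ψ'' = 1 →
            IsGroundStateInSector (hubbardTorus 2 L'' 1 U) (2 * ⌊(1 - δ) * (L'' : ℝ) ^ 2 / 2⌋₊) 0 ψ'' →
              θ * (L'' : ℝ) ^ 2 ≤ pairStructureFactor dWaveFormFactor L'' ψ'' 0) →
        ∀ ψ : Fock (Orb (FermionTorus 2 L)), star ψ ⬝ᵥ ψ = 1 →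
          IsGroundStateInSector (hubbardTorus 2 L 1 U) (2 * ⌊(1 - δ) * (L : ℝ) ^ 2 / 2⌋₊) 0 ψ →
            C * θ * (L : ℝ) ^ 2 ≤
              ∑ m ∈ Finset.univ.filter
                  (fun m : Fin 2 → ZMod L => momentumNormSq L m ≤ (2 * Real.pi / (L' : ℝ)) ^ 2),
                pairStructureFactor dWaveFormFactor L ψ m) →
    (∀ (a b : ℝ), 0 < a → a < b → b < 1 / 2 → ∃ K C E L₀ Ustar : ℝ, 1 ≤ K ∧ 0 < C ∧ 0 ≤ E ∧
      0 < Ustar ∧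
      ∀ (U δ θ : ℝ) (L' L : ℕ) [NeZero L'] [NeZero L], 0 < U → U < Ustar → δ ∈ Set.Icc a b →
        Even L' → Even L → L₀ ≤ L' → K * L' ≤ L →
        (∀ δ' ∈ Set.Icc a b, ∀ (L'' : ℕ) [NeZero L''], Even L'' → (L' : ℝ) ≤ K * L'' → L'' ≤ L' →
          ∀ ψ'' : Fock (Orb (FermionTorus 2 L'')), star ψ'' ⬝ᵥ ψ'' = 1 →
            IsGroundStateInSector (hubbardTorus 2 L'' 1 U) (2 * ⌊(1 - δ') * (L'' : ℝ) ^ 2 / 2⌋₊) 0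
                ψ'' →
              θ * (L'' : ℝ) ^ 2 ≤ pairStructureFactor dWaveFormFactor L'' ψ'' 0) →
        ∀ ψ : Fock (Orb (FermionTorus 2 L)), star ψ ⬝ᵥ ψ = 1 →
          IsGroundStateInSector (hubbardTorus 2 L 1 U) (2 * ⌊(1 - δ) * (L : ℝ) ^ 2 / 2⌋₊) 0 ψ →
            C * θ * (L : ℝ) ^ 2 - E * (L : ℝ) ^ 2 / (L' : ℝ) ^ 2 ≤
              ∑ m ∈ Finset.univ.filter
                  (fun m : Fin 2 → ZMod L =>
                    momentumNormSq L m ≤ (2 * Real.pi * K / (L' : ℝ)) ^ 2),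
                pairStructureFactor dWaveFormFactor L ψ m) := by
  intro hVM a b ha hab hb
  obtain ⟨C, L₀, Ustar, hC, hUstar, hVM⟩ := hVM a b ha hab hb
  refine ⟨2, C, 0, L₀, Ustar, by norm_num, hC, le_rfl, hUstar, ?_⟩
  intro U δ θ L' L _ _ hU0 hUst hδ hL'even hLeven hL₀ hKL hin ψ hψ hGS
  have hL'r : (0 : ℝ) < (L' : ℝ) := Nat.cast_pos.2 (Nat.pos_of_ne_zero (NeZero.ne L'))
  have hL'leL : L' ≤ L := by
    have h : (L' : ℝ) ≤ (L : ℝ) := by linarith [hL'r.le]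
    exact_mod_cast h
  have hin' : ∀ (L'' : ℕ) [NeZero L''], Even L'' → (L' : ℝ) ≤ 2 * L'' → L'' ≤ L' →
      ∀ ψ'' : Fock (Orb (FermionTorus 2 L'')), star ψ'' ⬝ᵥ ψ'' = 1 →
        IsGroundStateInSector (hubbardTorus 2 L'' 1 U) (2 * ⌊(1 - δ) * (L'' : ℝ) ^ 2 / 2⌋₊) 0 ψ'' →
          θ * (L'' : ℝ) ^ 2 ≤ pairStructureFactor dWaveFormFactor L'' ψ'' 0 :=
    fun L'' _ hL''even hge hle ψ'' hψ'' hGS'' => hin δ hδ L'' hL''even hge hle ψ'' hψ'' hGS''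
  have hmain := hVM U δ θ L' L hU0 hUst hδ hL'even hLeven hL₀ hL'leL hin' ψ hψ hGS
  have hrad : (2 * Real.pi / (L' : ℝ)) ^ 2 ≤ (2 * Real.pi * 2 / (L' : ℝ)) ^ 2 := by
    have h1 : 2 * Real.pi / (L' : ℝ) ≤ 2 * Real.pi * 2 / (L' : ℝ) := by
      apply div_le_div_of_nonneg_right _ hL'r.le
      linarith [Real.pi_pos]
    have h0 : 0 ≤ 2 * Real.pi / (L' : ℝ) := by positivity
    exact pow_le_pow_left₀ h0 h1 2
  have hsub : Finset.univ.filter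
        (fun m : Fin 2 → ZMod L => momentumNormSq L m ≤ (2 * Real.pi / (L' : ℝ)) ^ 2) ⊆
      Finset.univ.filter
        (fun m : Fin 2 → ZMod L => momentumNormSq L m ≤ (2 * Real.pi * 2 / (L' : ℝ)) ^ 2) := by
    intro m hm
    simp only [Finset.mem_filter, Finset.mem_univ, true_and] at hm ⊢
    exact le_trans hm hrad
  have hmono := Finset.sum_le_sum_of_subset_of_nonneg hsub
    (fun m _ _ => pairStructureFactor_nonneg dWaveFormFactor L ψ m)
  have h0 : (0 : ℝ) * (L : ℝ) ^ 2 / (L' : ℝ) ^ 2 = 0 := by simp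
  rw [h0, sub_zero]
  exact le_trans hmain hmono

end Summit.HubbardSuperconductivity.HubbardSuperconductivity.Theorems.InfraredCompletion

end
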